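import Summits.AtomisticToContinuum.Crystallization.Theorems.ChargedEnergyGapPoolCells
import Summits.AtomisticToContinuum.Crystallization.Theorems.ChargedEnergyGapConvexPiecesCascade
import HarnessLib

/-!

# ChargedEnergyGap · NODE 78R «PoolBalls» (lens-3 g79) — the REPAIRED pool transport beneath 76R's leaf (KX), replacing NODE 78's fattened tubes

**CONVEX-PIECES EDITION of NODE 78R (critic row 1434, repair of record R1c; supersedes the HELD unprimed file of the same node).**  Every
`∀ (m) (D) (σ)`-statement of this node carries the admissibility binder `(∀ i, IsConvexPieces (2 * ϱχ) (D i))` right after the invariance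
binder (names primed: `…Q'`), the glue concludes the PRIMED crease/transition ledger (KX)′ `CreaseTransitionLedgerQ'` of
`…ChargedEnergyGapConvexPieces`, and the cone is threaded through `chargedEnergyGap_of_convexPieces_numerics'` of `…ConvexPiecesCascade`
(reduction leaf (N-q)′ `LocalSeamReductionQ'`).  Proofs: verbatim with the binder `hcv` threaded.  The census numbers quoted below were computed
for the configurations of the g77–g79 desks, all of which are admissible lists (slabs, half-space cuts, tubes, dipoles as far-apart convex cells).

Line of record: `stmt-AtomisticToContinuum-14231` (`Summit.AtomisticToContinuum.ChargedEnergyGap`); target = the cone binder `hKX` of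
`chargedEnergyGap_of_roofCover_numerics`, VERBATIM

  (KX) `CreaseTransitionLedgerQ cls₀ 20 106 (1/3600000000) (3/5) (1/3) 3 (3/100) 160 80 (6/5) (3/2) (679/1000) (691/1000) (1/60000000) (1/2000000)`.

## Why a repair (negative knowledge on NODE 78's leaf (P_C), desk census g79)

NODE 78 lets a heavy active octahedron draw, cost-proportionally, from the reference sites of its N-FATTENED TUBE `tubeN` = the union of the
NODE-77 beam tubes of the HEAVY ACTIVE octahedra within `R_N`.  Beam tubes only sweep the budget columns based at HEAVY crease elements, so at the
BOUNDARY of a heavy crease region an octahedron sees half a disc of columns while every column it sees is loaded by a full disc of heavy cost: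
for a straight boundary with uniform cost and pool the boundary octahedron's coverage is `(∫_{half disc} dA(u)/|B(u,R_N) ∩ H|)·(pool/cost)
≈ 0.72–0.75 × the interior value`, at EVERY `R_N`.  Desk census (`num/plates.py`, mean-field, conventions of g76/g78): the RIM of a finite starved
slab (C = two coaxial discs of radius `R_p ≫ R_N` at distance `2L = 236`, χ-neighbourhoods of radius `37.3`, σ = true; interior = the g76 worst slab,
coverage `1.165–1.185`; at the rim the crease cost tapers over `≈ 40`): the last heavy rim octahedron has coverage `0.89` at `R_N = 80`, `0.87 / 0.86
/ 0.85 / 0.83` at `R_N = 100 / 120 / 160 / 240` ⇒ (P_C) `CreasePoolQ cls₀ 80 3 20 130 106 …` is FALSE-leaning and NOT repairable by re-dialling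
`R_N`; the same end effect gives `1.035` at the live/dead edge of a laterally cut slab (`num/lateral.py`) and `1.04–1.06` at the outer ends of the
dip bands of three line cores (`num/tjunc.py`, circumradius `130–133`).  (With the obliquity factor `L/D` that g78's `dipole.py` omitted, the
starved dipole family's worst under NODE 78 is `1.17`, not `1.23`.)

## The transport of NODE 78R (one move changed)

LIGHT/HEAVY, the vertex CHARGES and the POOL are NODE 78's (`Light`, `HeavyActive`, `charges`, `pool`, imported).  The fattened tube is replaced
by the BALL of radius `R_N` about the pair's first S-vertex: a heavy active ordered mid pair `(y, z)` draws from every reference site `x` with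
`dist x y ≤ R_N` the share `pool(x)·(frameVal/6)/ballLoad(x)`, where `ballLoad(x)` is the sum of `frameVal/6` over the heavy active ordered pairs
`(y', z')` with `dist x y' ≤ R_N` — ONE symmetric predicate, no beams, no feet, no Jacobians.  Its coverage `ballCoverage(y) := Σ_x pool(x)/ballLoad(x)`
over the ball; the leaf per heavy octahedron is again `1 ≤ ballCoverage`.  In a laterally homogeneous crease (the starved slab) nothing changes:
a site at height `s` is loaded by the heavy cost of the sheet disc of radius `√(R_N² − s²)` about it and the ball of a crease octahedron contains
exactly that disc of sites at height `s`, so `ballCoverage = (column pool)/(sheet cost) = 1.165` as soon as `R_N ≥ 38` (all budget heights inside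
the ball) — the g76 worst slab REMAINS the extremal family.  Everywhere else the ball taps pool that no beam reaches (transition shells around
point and line cores, the columns beyond a taper, the χ-rich strip at a lateral cut), and a boundary octahedron now sees the FULL ball while the
sites beyond the boundary are loaded only by the few heavy octahedra near it.  Desk census at `R_N = 80` (mean-field; `num/RESULTS-g79.md`):
starved slab `1.165` (exact: column ratio, the whole g76 grid `≥ 1.164`) · finite-slab rim `≥ 1.16` (interior-limited; rim end `≫ 1`) · laterally
cut slab `≥ 1.17` (interior-limited) · three line cores, circumradius `110–142`: `≥ 1.93` · starved dipole family `L = 110–118`: `≥ 9` · cylindrical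
voids `R_c = 118–124`: `≥ 100` (only the axis octahedra cost, `≤ 19.4 c_T` each).  Locality: a ball of radius `R_N` of sites, loads fixed within `2R_N`.

## The cut

  (KX) ⟸ (Z_K) `SixFeetZeroConeQ (679/1000) (691/1000) 330 130 160` [tree leaf of NODE 77, unchanged · FINITE · cell-LP]
      ∧ (P_C°) `CreaseBallQ' cls₀ 80 20 130 106 …` [RESIDUAL-DECIDING · NEW · TRUE-leaning `≥ 1.16` on SIX families at `R_N = 80`, extremal = the
        starved slab `1.165` (laterally homogeneous ⇒ ball coverage = inverse g76 ratio) · LOCAL (`R_N`, loads `2R_N`) · INSTRUMENTABLE · ATTACKABLE-L;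
        door [FROZEN-LOADS, g79 NODE 79]: Cauchy–Schwarz `ballCoverage ≥ Π²/Ξ` (Π = ball pool, Ξ = Σ pool·ballLoad; loss `< 0.2 %` in the slab)
        ∧ loads frozen by an any-feet depth-bucket cost table ∧ the frozen matching `Ξ_Φ ≤ Π²`]
      ∧ (P_D°) `BandBallQ' cls₀ 80 20 130 106 …` [NEW · TRUE-leaning, margin `≈ 3` (bulk band edge, as (B_D)/(P_D)); light hoverers exempt; a heavy
        tame octahedron at height `h ≤ 23` inside a crease patch keeps `(R_N² − h²)/R_N² × 1.165 ≥ 1.07` · LOCAL]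
      ∧ (N_P°) `BallIncidenceQ' cls₀ 80 20 130 106 …` [support · TRUE at the designate (`6κ ≤ c_T`; `36` ordered mid pairs per site; six
        vertices per framed pair) · ATTACKABLE-M: two periodic Fubini refoldings, no LP content].

Glue `creaseTransitionLedgerQ'_of_balls`, designate `creaseTransitionLedgerQ'_designate_of_balls` and the q-designate cone
`chargedEnergyGap_of_poolBallsConvex_numerics` are PROVED below (0 sorry) — NODE 78's glue verbatim with `paid ↦ ballPaid`.  Jointly the four leaves are
STRONGER than (KX) (a specific transport).

Imports ONLY the tree file `…ChargedEnergyGapPoolCells` (NODE 78: `Light`, `HeavyActive`, `charges`, `pool`, `pool_nonneg`; hence `…BeamCells`,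
`…RoofCover`) and `HarnessLib`; no `set_option`, no `sorry`, no instance, no notation.  Same namespace; new declaration names `ballLoad`,
`ballCoverage`, `ballPaid`, `CreaseBallQ'`, `BandBallQ'`, `BallIncidenceQ'` (+ lemmas; no clash in the tree namespace, checked).
-/

noncomputable section

open scoped Classical
open Literature.MathematicalPhysics.StatisticalMechanics Literature.Geometry.DiscreteGeometry
open Summit.AtomisticToContinuum.Crystallization.Theses.PricedLinkCensus
open Summit.AtomisticToContinuum.Crystallization.Theorems.ChargedEnergyGapNegative

namespace Summit.AtomisticToContinuum.Crystallization.Theorems.ChargedEnergyGapChartDial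

/-! ## §1 The ball load, the ball coverage and the ball payment -/

section Balls

variable (ϱχ : ℝ) {m : ℕ} (D : Fin m → Set E3) (σ : Fin m → Bool)

/-- ★ The **BALL LOAD** at `x`: the sum of `frameVal/6` over the heavy active ordered mid pairs `(y', z')` whose first S-vertex lies within `R_N`
of `x` (finsum; `0` if the support were infinite — it is finite for a separated reference). -/
def ballLoad (R_N r_f dK dstar κ c_T cχ : ℝ) (P : PeriodicConfiguration 3) (C X : Set E3) (τ ϱ r₁ r₂ : ℝ) (x : E3) : ℝ :=
  ∑ᶠ p : E3 × E3,
    if HeavyActive ϱχ D σ r_f dK dstar κ c_T cχ P C X τ ϱ r₁ r₂ p.1 p.2 ∧ dist x p.1 ≤ R_N then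
      (1 / 6) * frameVal (roofVal T75) τ (siteW ϱχ D σ X ϱ C) P r₁ p.1 p.2
    else 0

/-- ★ The **BALL COVERAGE** at the S-vertex `y` (the same for every ordered mid pair `(y, z)`): `Σ_x pool(x)/ballLoad(x)` over the reference sites `x`
with `dist x y ≤ R_N` — the income of a heavy octahedron under COST-PROPORTIONAL sharing over the ball, divided by its sixth-cost. -/
def ballCoverage (R_N r_f dK dstar κ c_T cχ : ℝ) (P : PeriodicConfiguration 3) (C X : Set E3) (τ ϱ r₁ r₂ : ℝ) (y : E3) : ℝ :=
  ∑ᶠ x : E3,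
    if x ∈ P.points ∧ dist x y ≤ R_N then
      pool ϱχ D σ r_f dK dstar κ c_T cχ P C X τ ϱ r₁ r₂ x / ballLoad ϱχ D σ R_N r_f dK dstar κ c_T cχ P C X τ ϱ r₁ r₂ x
    else 0

/-- ★ The **BALL PAYMENT** to the ordered mid pair `(y, z)`: its sixth-cost if it is light (own vertices), else its sixth-cost times its ball
coverage. -/
def ballPaid (R_N r_f dK dstar κ c_T cχ : ℝ) (P : PeriodicConfiguration 3) (C X : Set E3) (τ ϱ r₁ r₂ : ℝ) (y z : E3) : ℝ :=
  if Light ϱχ D σ r_f dstar κ c_T cχ P C X τ ϱ r₁ r₂ y z then (1 / 6) * frameVal (roofVal T75) τ (siteW ϱχ D σ X ϱ C) P r₁ y z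
  else (1 / 6) * frameVal (roofVal T75) τ (siteW ϱχ D σ X ϱ C) P r₁ y z *
    ballCoverage ϱχ D σ R_N r_f dK dstar κ c_T cχ P C X τ ϱ r₁ r₂ y

variable {ϱχ D σ}

/-- The ball load is non-negative (heavy active pairs have positive cost). [formal bookkeeping] -/
theorem ballLoad_nonneg (R_N r_f dK dstar κ c_T cχ : ℝ) (P : PeriodicConfiguration 3) (C X : Set E3) (τ ϱ r₁ r₂ : ℝ) (x : E3) :
    0 ≤ ballLoad ϱχ D σ R_N r_f dK dstar κ c_T cχ P C X τ ϱ r₁ r₂ x := by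
  unfold ballLoad
  refine finsum_nonneg fun p => ?_
  split_ifs with h
  · exact mul_nonneg (by norm_num) h.1.1.2.2.2.2.le
  · exact le_rfl

/-- The ball coverage is non-negative. [formal bookkeeping] -/
theorem ballCoverage_nonneg (R_N r_f dK dstar κ c_T cχ : ℝ) (P : PeriodicConfiguration 3) (C X : Set E3) (τ ϱ r₁ r₂ : ℝ) (y : E3) :
    0 ≤ ballCoverage ϱχ D σ R_N r_f dK dstar κ c_T cχ P C X τ ϱ r₁ r₂ y := by
  unfold ballCoverage
  refine finsum_nonneg fun x => ?_
  split_ifs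
  · exact div_nonneg (pool_nonneg r_f dK dstar κ c_T cχ P C X τ ϱ r₁ r₂ x) (ballLoad_nonneg R_N r_f dK dstar κ c_T cχ P C X τ ϱ r₁ r₂ x)
  · exact le_rfl

/-- The ball payment to an active pair is non-negative. [formal bookkeeping] -/
theorem ballPaid_nonneg {R_N r_f dK dstar κ c_T cχ : ℝ} {P : PeriodicConfiguration 3} {C X : Set E3} {τ ϱ r₁ r₂ : ℝ} {y z : E3}
    (hA : IsActive ϱχ D σ r_f dK P C X τ ϱ r₁ r₂ y z) : 0 ≤ ballPaid ϱχ D σ R_N r_f dK dstar κ c_T cχ P C X τ ϱ r₁ r₂ y z := by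
  unfold ballPaid
  split_ifs
  · exact mul_nonneg (by norm_num) hA.2.2.2.2.le
  · exact mul_nonneg (mul_nonneg (by norm_num) hA.2.2.2.2.le) (ballCoverage_nonneg R_N r_f dK dstar κ c_T cχ P C X τ ϱ r₁ r₂ y)

/-- ★ The sixth-cost of an active pair is at most its ball payment, provided its ball coverage is `≥ 1` in case it is heavy.
[the pointwise step of the glue] -/
theorem frameVal_le_ballPaid {R_N r_f dK dstar κ c_T cχ : ℝ} {P : PeriodicConfiguration 3} {C X : Set E3} {τ ϱ r₁ r₂ : ℝ} {y z : E3}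
    (hA : IsActive ϱχ D σ r_f dK P C X τ ϱ r₁ r₂ y z)
    (hcov : ¬Light ϱχ D σ r_f dstar κ c_T cχ P C X τ ϱ r₁ r₂ y z →
      1 ≤ ballCoverage ϱχ D σ R_N r_f dK dstar κ c_T cχ P C X τ ϱ r₁ r₂ y) :
    (1 / 6) * frameVal (roofVal T75) τ (siteW ϱχ D σ X ϱ C) P r₁ y z ≤ ballPaid ϱχ D σ R_N r_f dK dstar κ c_T cχ P C X τ ϱ r₁ r₂ y z := by
  unfold ballPaid
  split_ifs with hL
  · exact le_rfl
  · exact le_mul_of_one_le_right (mul_nonneg (by norm_num) hA.2.2.2.2.le) (hcov hL)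

end Balls

/-! ## §2 The leaves -/

section Leaves

/-- ★★★ **(P_C°) THE CREASE BALL INEQUALITY** — per octahedron, LOCAL (sites within `R_N`, loads fixed within `2R_N`): a HEAVY ACTIVE CREASED
octahedron (feet of its sites more than `r_f` apart; cost above the atom of one of its sites) has BALL COVERAGE at least `1`: the pool of the
reference sites within `R_N` of its first S-vertex, each divided by its ball load, adds up to `≥ 1` — equivalently its cost-proportional income
`(1/6)·frameVal·ballCoverage` pays its sixth-cost.
[RESIDUAL-DECIDING · NEW as typed · TRUE-leaning at `R_N = 80` on six families (mean-field desk census g79): starved slab `1.165` = the extremal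
family (laterally homogeneous ⇒ ball coverage = column pool / sheet cost = the inverse g76 ratio, `≥ 1.164` on the whole g76 grid), finite-slab rim
`≥ 1.16`, laterally cut slab `≥ 1.17`, three line cores `≥ 1.93`, starved dipoles `≥ 9`, cylinders `≥ 100` · LOCAL · INSTRUMENTABLE (one octahedron
+ radius `2R_N`) · ATTACKABLE-L; door [FROZEN-LOADS]: Cauchy–Schwarz `ballCoverage ≥ Π²/Ξ` ∧ any-feet depth-bucket cost caps on the loads ∧ the
frozen matching `Ξ_Φ ≤ Π²`] -/
def CreaseBallQ' (cls : Set E3 → Prop) (R_N r_f dK dstar κ c_T cχ : ℝ) (s lam ℓ τ ϱ ϱχ r₁ r₂ ρlo ρhi : ℝ) : Prop :=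
  ∀ (P : PeriodicConfiguration 3) (C X : Set E3) (m : ℕ) (D : Fin m → Set E3) (σ : Fin m → Bool),
    IsSeparatedRef s P → IsLabelledRef lam ℓ P → cls P.points → IsForceFree P → IsSiteStressFree P →
    IsInvariantSet P C → IsInvariantSet P X → (∀ i, IsInvariantSet P (D i)) → (∀ i, IsConvexPieces (2 * ϱχ) (D i)) →
    IsFramedOct P r₁ r₂ ρlo ρhi →
    ∀ y z : E3, HeavyActive ϱχ D σ r_f dK dstar κ c_T cχ P C X τ ϱ r₁ r₂ y z → ¬OctTame r_f C P r₁ y z →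
      1 ≤ ballCoverage ϱχ D σ R_N r_f dK dstar κ c_T cχ P C X τ ϱ r₁ r₂ y

/-- ★★★ **(P_D°) THE BAND BALL INEQUALITY** — per octahedron, LOCAL: a HEAVY ACTIVE TAME octahedron (one foot cluster on `C`; being active and
tame it TOUCHES A χ-TRANSITION) has ball coverage `≥ 1`.
[NEW as typed · TRUE-leaning with margin: bulk band «near» factor edge: cost `21–62 c_T` per octahedron vs a band ball of `cχ`-atoms — margin `≈ 3`;
cheap χ-touching octahedra inside crease columns («hoverers») are LIGHT by a factor `≥ 6` and not concerned; a hypothetical heavy one at height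
`h ≤ 23` in a crease patch keeps `(R_N² − h²)/R_N² × 1.165 ≥ 1.07` at `R_N = 80` · LOCAL · INSTRUMENTABLE · ATTACKABLE-L; door [EDGE-TABLE]] -/
def BandBallQ' (cls : Set E3 → Prop) (R_N r_f dK dstar κ c_T cχ : ℝ) (s lam ℓ τ ϱ ϱχ r₁ r₂ ρlo ρhi : ℝ) : Prop :=
  ∀ (P : PeriodicConfiguration 3) (C X : Set E3) (m : ℕ) (D : Fin m → Set E3) (σ : Fin m → Bool),
    IsSeparatedRef s P → IsLabelledRef lam ℓ P → cls P.points → IsForceFree P → IsSiteStressFree P →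
    IsInvariantSet P C → IsInvariantSet P X → (∀ i, IsInvariantSet P (D i)) → (∀ i, IsConvexPieces (2 * ϱχ) (D i)) →
    IsFramedOct P r₁ r₂ ρlo ρhi →
    ∀ y z : E3, HeavyActive ϱχ D σ r_f dK dstar κ c_T cχ P C X τ ϱ r₁ r₂ y z → OctTame r_f C P r₁ y z →
      1 ≤ ballCoverage ϱχ D σ R_N r_f dK dstar κ c_T cχ P C X τ ϱ r₁ r₂ y

/-- ★★ **(N_P°) BALL INCIDENCE** (periodic double counting, twice): summed over the active mid pairs of one period, the ball payments amount to at
most the budget of (KX) without the near-priced term.  Light pairs: `(1/6)·frameVal = Σ over the six sites of frameVal/36`, refolded over the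
period = `Σ_x charges(x)`; heavy pairs: `Σ (1/6)·frameVal·ballCoverage = Σ_x pool(x)·[ballLoad(x) > 0] ≤ Σ_x pool(x)` (the pair `(y, z)` counts
the site `x` iff `dist x y ≤ R_N` iff the ball load at `x` counts `(y, z)`); `charges + pool = atom` at the designate; `Σ_{x ∈ motif} atom(x)` is the
right-hand side termwise.
[support · TRUE at the designate (`6κ ≤ c_T`) · ATTACKABLE-M (periodic Fubini as (I₃₆)/(N_B); lattice invariance of `atom`, `charges`, `ballLoad`,
`Light`, `IsActive`; local finiteness of the finsum supports for a separated reference) · no LP content] -/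
def BallIncidenceQ' (cls : Set E3 → Prop) (R_N r_f dK dstar κ c_T cχ : ℝ) (s lam ℓ τ ϱ ϱχ r₁ r₂ ρlo ρhi : ℝ) : Prop :=
  ∀ (P : PeriodicConfiguration 3) (C X : Set E3) (m : ℕ) (D : Fin m → Set E3) (σ : Fin m → Bool),
    IsSeparatedRef s P → IsLabelledRef lam ℓ P → cls P.points → IsInvariantSet P C → IsInvariantSet P X → (∀ i, IsInvariantSet P (D i)) →
    (∀ i, IsConvexPieces (2 * ϱχ) (D i)) →
    IsFramedOct P r₁ r₂ ρlo ρhi →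
      ∑ y ∈ P.motif, ∑ᶠ z : E3, (if (z ∈ P.points ∧ r₁ < dist y z ∧ dist y z ≤ r₂) ∧ IsActive ϱχ D σ r_f dK P C X τ ϱ r₁ r₂ y z then
          ballPaid ϱχ D σ R_N r_f dK dstar κ c_T cχ P C X τ ϱ r₁ r₂ y z else 0) ≤
        c_T * shellMassL ϱχ D σ P X ϱ C - 6 * κ * sVertMassL ϱχ D σ r_f dstar P C X ϱ r₁ r₂ + cχ * transMassL ϱχ D σ P X ϱ C

end Leaves

/-! ## §3 The glue: (Z_K) ∧ (P_C°) ∧ (P_D°) ∧ (N_P°) ⟹ (KX) -/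

section Glue

variable {ϱχ : ℝ}

/-- ★★★ **GLUE OF NODE 78R (PROVED)**: (Z_K) ∧ (P_C°) ∧ (P_D°) ∧ (N_P°) ⟹ (KX) `CreaseTransitionLedgerQ` (same constants, `c_H := 0`), for any
class, whenever `0 < ϱ`, `0 < ϱχ`, `0 ≤ r₁`, octahedra small against the χ-scale, positive half-diagonal window and `R_Z ≥ 2ϱ + 6ρhi`.  NODE 78's
glue with the ball payment: the residual class is PARTITIONED into the χ-free deep creases (free by (Z_K)), the inactive rest (free by definition) and
the ACTIVE octahedra, each paid at least its sixth-cost (`frameVal_le_ballPaid`: light ones by definition, heavy creased ones by (P_C°), heavy tame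
ones by (P_D°)); the payments of one period add up to at most the budget by (N_P°). -/
theorem creaseTransitionLedgerQ'_of_balls {cls : Set E3 → Prop} {R_N r_f dK R_Z dstar κ c_T cχ s lam ℓ τ ϱ ϱχ r₁ r₂ ρlo ρhi : ℝ}
    (hs : 0 < s) (hϱ : 0 < ϱ) (hϱχ : 0 < ϱχ) (hr₁ : 0 ≤ r₁) (hsmall : 2 * (r₁ + r₂) < ϱχ / 2) (hlo : 0 < ρlo) (hR : 2 * ϱ + 6 * ρhi ≤ R_Z)
    (hZ : SixFeetZeroConeQ ρlo ρhi R_Z dK ϱ)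
    (hPC : CreaseBallQ' cls R_N r_f dK dstar κ c_T cχ s lam ℓ τ ϱ ϱχ r₁ r₂ ρlo ρhi)
    (hPD : BandBallQ' cls R_N r_f dK dstar κ c_T cχ s lam ℓ τ ϱ ϱχ r₁ r₂ ρlo ρhi)
    (hN : BallIncidenceQ' cls R_N r_f dK dstar κ c_T cχ s lam ℓ τ ϱ ϱχ r₁ r₂ ρlo ρhi) :
    CreaseTransitionLedgerQ' cls r_f dstar κ s lam ℓ τ ϱ ϱχ r₁ r₂ ρlo ρhi c_T cχ := by
  refine ⟨0, le_rfl, fun P C X m D σ h1 h2 hcl h3 h4 h6' h7 h11 hcv hFr => ?_⟩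
  -- abbreviations of the octahedron predicates
  set cf : E3 → E3 → Prop := fun y z => OctChiFree ϱχ D P r₁ y z with hcf
  set tm : E3 → E3 → Prop := fun y z => OctTame r_f C P r₁ y z with htm
  set dp : E3 → E3 → Prop := fun y z => OctDeep dK C P r₁ y z with hdp
  set fv : E3 → E3 → ℝ := fun y z => frameVal (roofVal T75) τ (siteW ϱχ D σ X ϱ C) P r₁ y z with hfv
  -- the partition  KX = Z ⊔ R,  R = N ⊔ A
  have s1 := fShellSel_split (ϱχ := ϱχ) (D := D) (σ := σ) (π := fun y z => ¬(cf y z ∧ tm y z))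
    (π₁ := fun y z => cf y z ∧ ¬tm y z ∧ dp y z)
    (π₂ := fun y z => ¬(cf y z ∧ tm y z) ∧ ¬(cf y z ∧ ¬tm y z ∧ dp y z)) h1 hs
    (fun y z => by
      constructor
      · intro h
        by_cases hZ' : cf y z ∧ ¬tm y z ∧ dp y z
        · exact Or.inl hZ'
        · exact Or.inr ⟨h, hZ'⟩
      · rintro (h | h)
        · exact fun h' => h.2.1 h'.2
        · exact h.1)
    (fun y z h => h.2.2 h.1) (roofVal T75) r₁ r₂ τ X ϱ C
  have s2 := fShellSel_split (ϱχ := ϱχ) (D := D) (σ := σ)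
    (π := fun y z => ¬(cf y z ∧ tm y z) ∧ ¬(cf y z ∧ ¬tm y z ∧ dp y z))
    (π₁ := fun y z => (¬(cf y z ∧ tm y z) ∧ ¬(cf y z ∧ ¬tm y z ∧ dp y z)) ∧ ¬(0 < fv y z))
    (π₂ := fun y z => (¬(cf y z ∧ tm y z) ∧ ¬(cf y z ∧ ¬tm y z ∧ dp y z)) ∧ 0 < fv y z) h1 hs
    (fun y z => by
      constructor
      · intro h
        by_cases hp : 0 < fv y z
        · exact Or.inr ⟨h, hp⟩
        · exact Or.inl ⟨h, hp⟩
      · rintro (h | h) <;> exact h.1)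
    (fun y z h => h.1.2 h.2.2) (roofVal T75) r₁ r₂ τ X ϱ C
  -- (Z_K): the χ-free deep creases are free
  have eZ : fShellSel ϱχ D σ (fun y z => cf y z ∧ ¬tm y z ∧ dp y z) (roofVal T75) r₁ r₂ τ P X ϱ C ≤ 0 :=
    fShellSel_nonpos h1 hs fun y hy z hz hd1 hd2 hc hp hπ =>
      frameVal_nonpos_of_anyFeetZeroCone hϱ hϱχ hr₁ hsmall hlo hR hZ hFr (P.mem_points_of_mem_motif hy) hz hd1 hd2 hc hp hπ.1 hπ.2.2
  -- the inactive rest is free by definition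
  have eN : fShellSel ϱχ D σ (fun y z => (¬(cf y z ∧ tm y z) ∧ ¬(cf y z ∧ ¬tm y z ∧ dp y z)) ∧ ¬(0 < fv y z))
      (roofVal T75) r₁ r₂ τ P X ϱ C ≤ 0 :=
    fShellSel_nonpos h1 hs fun y _ z _ _ _ _ _ hπ => not_lt.1 hπ.2
  -- the active octahedra are paid at least their sixth-costs
  set R : E3 → E3 → ℝ := fun y z =>
    if IsActive ϱχ D σ r_f dK P C X τ ϱ r₁ r₂ y z then ballPaid ϱχ D σ R_N r_f dK dstar κ c_T cχ P C X τ ϱ r₁ r₂ y z else 0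
    with hRdef
  have hR0 : ∀ y z, 0 ≤ R y z := fun y z => by
    simp only [hRdef]
    split_ifs with hA
    · exact ballPaid_nonneg hA
    · exact le_rfl
  have eA : fShellSel ϱχ D σ (fun y z => (¬(cf y z ∧ tm y z) ∧ ¬(cf y z ∧ ¬tm y z ∧ dp y z)) ∧ 0 < fv y z)
      (roofVal T75) r₁ r₂ τ P X ϱ C ≤
      ∑ y ∈ P.motif, ∑ᶠ z : E3, (if z ∈ P.points ∧ r₁ < dist y z ∧ dist y z ≤ r₂ then R y z else 0) := by
    refine fShellSel_le_of_termwise h1 hs R hR0 fun y hy z hz hd1 hd2 hc hp hπ => ?_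
    have hact : IsActive ϱχ D σ r_f dK P C X τ ϱ r₁ r₂ y z := by
      refine ⟨⟨P.mem_points_of_mem_motif hy, hz, hd1, hd2⟩, hc, hp, ?_, hπ.2⟩
      rintro ⟨hc', ht' | hd'⟩
      · exact hπ.1.1 ⟨hc', ht'⟩
      · by_cases ht : tm y z
        · exact hπ.1.1 ⟨hc', ht⟩
        · exact hπ.1.2 ⟨hc', ht, hd'⟩
    have hRe : R y z = ballPaid ϱχ D σ R_N r_f dK dstar κ c_T cχ P C X τ ϱ r₁ r₂ y z := by simp only [hRdef, if_pos hact]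
    rw [hRe]
    refine frameVal_le_ballPaid hact fun hH => ?_
    by_cases ht : OctTame r_f C P r₁ y z
    · exact hPD P C X m D σ h1 h2 hcl h3 h4 h6' h7 h11 hcv hFr y z ⟨hact, hH⟩ ht
    · exact hPC P C X m D σ h1 h2 hcl h3 h4 h6' h7 h11 hcv hFr y z ⟨hact, hH⟩ ht
  -- (N_P°): the payments add up to the budget
  have eI := hN P C X m D σ h1 h2 hcl h6' h7 h11 hcv hFr
  have hsum : ∑ y ∈ P.motif, ∑ᶠ z : E3, (if z ∈ P.points ∧ r₁ < dist y z ∧ dist y z ≤ r₂ then R y z else 0) =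
      ∑ y ∈ P.motif, ∑ᶠ z : E3, (if (z ∈ P.points ∧ r₁ < dist y z ∧ dist y z ≤ r₂) ∧ IsActive ϱχ D σ r_f dK P C X τ ϱ r₁ r₂ y z then
          ballPaid ϱχ D σ R_N r_f dK dstar κ c_T cχ P C X τ ϱ r₁ r₂ y z else 0) := by
    refine Finset.sum_congr rfl fun y _ => finsum_congr fun z => ?_
    by_cases hA : z ∈ P.points ∧ r₁ < dist y z ∧ dist y z ≤ r₂
    · by_cases hB : IsActive ϱχ D σ r_f dK P C X τ ϱ r₁ r₂ y z
      · rw [if_pos hA, if_pos ⟨hA, hB⟩]; simp only [hRdef, if_pos hB]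
      · rw [if_pos hA, if_neg fun h => hB h.2]; simp only [hRdef, if_neg hB]
    · rw [if_neg hA, if_neg fun h => hA h.1]
  rw [s1, s2, zero_mul, add_zero]
  rw [hsum] at eA
  linarith

end Glue

/-! ## §4 The designate: NODE 78R beneath NODE 76R, and the q-designate cone through the pool balls -/

section Designate

/-- ★★★ **NODE 78R AT THE DESIGNATE (PROVED)**: with ball radius `R_N = 80`, `r_f = 20`, crease depth `d_K = 130`, feet diameter `R_Z = 330`,
`d⋆ = 106`, `κ = c_T/60`: (Z_K) ∧ (P_C°) ∧ (P_D°) ∧ (N_P°) ⟹ (KX) `CreaseTransitionLedgerQ cls₀ 20 106 (1/3600000000) (3/5) (1/3) 3 (3/100) 160 80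
(6/5) (3/2) (679/1000) (691/1000) (1/60000000) (1/2000000)`. -/
theorem creaseTransitionLedgerQ'_designate_of_balls
    (hZK : SixFeetZeroConeQ (679 / 1000) (691 / 1000) 330 130 160)
    (hPC : CreaseBallQ' cls₀ 80 20 130 106 (1 / 3600000000) (1 / 60000000) (1 / 2000000) (3 / 5) (1 / 3) 3 (3 / 100) 160 80 (6 / 5)
      (3 / 2) (679 / 1000) (691 / 1000))
    (hPD : BandBallQ' cls₀ 80 20 130 106 (1 / 3600000000) (1 / 60000000) (1 / 2000000) (3 / 5) (1 / 3) 3 (3 / 100) 160 80 (6 / 5)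
      (3 / 2) (679 / 1000) (691 / 1000))
    (hN : BallIncidenceQ' cls₀ 80 20 130 106 (1 / 3600000000) (1 / 60000000) (1 / 2000000) (3 / 5) (1 / 3) 3 (3 / 100) 160 80 (6 / 5)
      (3 / 2) (679 / 1000) (691 / 1000)) :
    CreaseTransitionLedgerQ' cls₀ 20 106 (1 / 3600000000) (3 / 5) (1 / 3) 3 (3 / 100) 160 80 (6 / 5) (3 / 2) (679 / 1000) (691 / 1000)
      (1 / 60000000) (1 / 2000000) :=
  creaseTransitionLedgerQ'_of_balls (by norm_num) (by norm_num) (by norm_num) (by norm_num) (by norm_num) (by norm_num) (by norm_num)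
    hZK hPC hPD hN

/-- ★★★ **THE q-DESIGNATE THROUGH THE POOL BALLS**: the tree cone `chargedEnergyGap_of_roofCover_numerics` with (KX) replaced by the four leaves of
NODE 78R — (Z_K) `SixFeetZeroConeQ … 330 130 160`, (P_C°) `CreaseBallQ'`, (P_D°) `BandBallQ'`, (N_P°) `BallIncidenceQ'` — everything else verbatim. -/
theorem chargedEnergyGap_of_poolBallsConvex_numerics {b₁ : ℝ} (hb : 1 / 8 ≤ b₁) (hU : Fcc.FccScaleNumerics) (hF : ChargeRecount)
    (hIP : ImprovablePricingG (3 / 20) (1 / 10) (6 / 5) 10 (1 / 100) (3 / 5))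
    (hFCP : FrustratedCorePricingG (3 / 20) (1 / 10) (6 / 5) 10 (1 / 100) 40 (3 / 5))
    (hCCP : CoherentCorePricingG (3 / 20) (1 / 10) (6 / 5) 10 (1 / 100) 40 (1 / 10) 40 (3 / 5))
    (hB : CoreBallRegularPricingW (maxCoverWeights (3 / 20) (1 / 10) (6 / 5) 10 (1 / 100) 40 (1 / 10) 40 160) (1 / 20) (3 / 5) 10
      fun _ _ => True)
    (hLab : CleanLabellingW (maxCoverWeights (3 / 20) (1 / 10) (6 / 5) 10 (1 / 100) 40 (1 / 10) 40 160) (3 / 5) 10 (1 / 3) 3)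
    (hSB : ShellBudgetW (maxCoverWeights (3 / 20) (1 / 10) (6 / 5) 10 (1 / 100) 40 (1 / 10) 40 160) (3 / 5) 100000)
    (hLf : LoadBoundQ IsFccImage (3 / 5) (1 / 3) 3 (1 / 100) (3 / 100) 160 (2 / 5) 3 b₁ 80 (6 / 5) (3 / 4) (3 / 10000000) (9 / 1000000))
    (hNf : NnStiffCls IsFccImage (27 / 10) (6 / 5))
    (hOL : OctLedgerQ (IsCubicFccImage (1921 / 2000) (977 / 1000)) (3 / 5) (1 / 3) 3 (1 / 100) (3 / 100) 160 (2 / 5) 3 b₁ 80 (6 / 5) (3 / 2)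
      (1 / 2) (679 / 1000) (691 / 1000))
    (hA : A0Plus) (hSh : ShellIsSecond (IsCubicFccImage (Fcc.a0 * Real.sqrt 2) (Fcc.a0 * Real.sqrt 2)))
    (hT : RoofTableQ (471 / 1000) T75)
    (hZ : SixFeetZeroConeQ (679 / 1000) (691 / 1000) 20 106 160)
    (hCap : SixFeetShallowCapQ (679 / 1000) (691 / 1000) 20 106 160 (3 / 100) (1 / 3600000000))
    (hI : SVertexIncidenceQ cls₀ 20 106 36 (3 / 5) (1 / 3) 3 160 80 (6 / 5) (3 / 2))
    (hZK : SixFeetZeroConeQ (679 / 1000) (691 / 1000) 330 130 160)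
    (hPC : CreaseBallQ' cls₀ 80 20 130 106 (1 / 3600000000) (1 / 60000000) (1 / 2000000) (3 / 5) (1 / 3) 3 (3 / 100) 160 80 (6 / 5)
      (3 / 2) (679 / 1000) (691 / 1000))
    (hPD : BandBallQ' cls₀ 80 20 130 106 (1 / 3600000000) (1 / 60000000) (1 / 2000000) (3 / 5) (1 / 3) 3 (3 / 100) 160 80 (6 / 5)
      (3 / 2) (679 / 1000) (691 / 1000))
    (hNP : BallIncidenceQ' cls₀ 80 20 130 106 (1 / 3600000000) (1 / 60000000) (1 / 2000000) (3 / 5) (1 / 3) 3 (3 / 100) 160 80 (6 / 5)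
      (3 / 2) (679 / 1000) (691 / 1000))
    (hFf : FarTrussQ IsFccImage (3 / 5) (1 / 3) 3 (1 / 100) (3 / 100) 160 (2 / 5) 3 b₁ 80 (6 / 5) (3 / 2) (11 / 20) (1 / 25) (1 / 60000000)
      (1 / 2000000))
    (hGf : GeoExchQ IsFccImage (3 / 5) (1 / 3) 3 (1 / 100) (3 / 100) 160 (2 / 5) 3 b₁ 80 (6 / 5) (3 / 20) (1 / 25) (1 / 30000000) (1 / 1000000))
    (hLh : LoadBoundQ IsHcpImage (3 / 5) (1 / 3) 3 (1 / 100) (3 / 100) 160 (2 / 5) 3 b₁ 80 (6 / 5) (3 / 4) (3 / 10000000) (9 / 1000000))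
    (hNh : NnStiffCls IsHcpImage (27 / 10) (6 / 5))
    (hMh : MidTrussQ IsHcpImage (3 / 5) (1 / 3) 3 (1 / 100) (3 / 100) 160 (2 / 5) 3 b₁ 80 (6 / 5) (3 / 2) (1 / 2) 0 (1 / 60000000) (1 / 2000000))
    (hFh : FarTrussQ IsHcpImage (3 / 5) (1 / 3) 3 (1 / 100) (3 / 100) 160 (2 / 5) 3 b₁ 80 (6 / 5) (3 / 2) (1 / 2) (1 / 40) (1 / 60000000)
      (1 / 2000000))
    (hGh : GeoExchQ IsHcpImage (3 / 5) (1 / 3) 3 (1 / 100) (3 / 100) 160 (2 / 5) 3 b₁ 80 (6 / 5) (1 / 5) (1 / 40) (1 / 30000000) (1 / 1000000))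
    (hN : LocalSeamReductionQ' (3 / 5) (1 / 3) 3 (1 / 100) (3 / 100) (1 / 2) 160 (2 / 5) 3 b₁ 80 (1 / 3000000) (1 / 100000)
      (maxCoverWeights (3 / 20) (1 / 10) (6 / 5) 10 (1 / 100) 40 (1 / 10) 40 160) (1 / 20) 10 100000)
    (hP : ChartedChargePricingG (3 / 20) (1 / 10) (3 / 5)) : ChargedEnergyGap :=
  chargedEnergyGap_of_convexPieces_numerics' hb hU hF hIP hFCP hCCP hB hLab hSB hLf hNf hOL hA hSh hT hZ hCap hI
    (creaseTransitionLedgerQ'_designate_of_balls hZK hPC hPD hNP) hFf hGf hLh hNh hMh hFh hGh hN hP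

end Designate

end Summit.AtomisticToContinuum.Crystallization.Theorems.ChargedEnergyGapChartDial
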